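import Mathlib
import HarnessLib
import Literature.Computability.LLVMLangRef18.BitManipulationIntrinsics
import Literature.Computability.LLVMLangRef18.UndefinedValues

/-!
# LLVM Language Reference Manual, release 18.1.3: vector operands — integer instructions act ELEMENT BY ELEMENT; division UB is ANY-element; `or disjoint` poison is PER-element; vector `select`; refinement of vectors element-wise (Alive2)

Source followed verbatim: *LLVM Language Reference Manual*, release 18.1.3 [LLVMLangRef18] — `docs/LangRef.rst` at tag `llvmorg-18.1.3`
(pinned copy `inputs/llvm-18.1.3.src/docs/LangRef.rst` of the CertifiedToolchain cell), and for the refinement of vector values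
Lopes–Lee–Hur–Liu–Regehr, *Alive2: Bounded Translation Validation for LLVM*, PLDI 2021 [LopesEtAl2021], Figure 4 rule (value-aggregate).
Fifth companion of `IntegerIntrinsics` / `BinaryOperators` / `BitManipulationIntrinsics` / `UndefinedValues`, which type the SCALAR
instructions; this file types what the manual prints about their VECTOR forms, as liftings of those scalar definitions.

Printed.  §'Vector Type' (L3950–3956): "A vector type is a simple derived type that represents a vector of elements. Vector types are used
when multiple primitive data are operated in parallel using a single instruction (SIMD). A vector type requires a size (number of elements),
an underlying primitive data type, and a scalable property […]."  §'add' Arguments (L9254–9256; likewise `sub`/`mul`/`and`/`or`/`xor`, the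
divisions and the shifts): "The two arguments to the '``add``' instruction must be :ref:`integer <t_integer>` or :ref:`vector <t_vector>` of
integer values. Both arguments must have identical types."  §'shl' (L9856–9857; identical sentences §'lshr' L9909–9910, §'ashr' L9961–9962):
"If the arguments are vectors, each vector element of ``op1`` is shifted by the corresponding shift amount in ``op2``."  §'llvm.fshl.*'
(L16303–16304; §'llvm.fshr.*' L16351–16352): "For vector types, the operation occurs for each element of the vector."  §'udiv' (L9549–9550;
identical §'sdiv' L9598–9599, §'urem' L9690–9691, §'srem' L9744–9745): "Division by zero is undefined behavior. For vectors, if any element of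
the divisor is zero, the operation has undefined behavior."  §'or' (L10075–10077): "If the disjoint keyword is present, the result value of the
``or`` is a :ref:`poison value <poisonvalues>` if both inputs have a one in the same bit position. For vectors, only the element containing the
bit is poison."  §'icmp' (L11922–11924): "If the operands are integer vectors, then they are compared element by element. The result is an
``i1`` vector with the same number of elements as the values being compared. Otherwise, the result is an ``i1``."  §'select' (L12152–12155):
"If the condition is a vector of i1, then the value arguments must be vectors of the same size, and the selection is done element by element.
If the condition is an i1 and the value arguments are vectors of the same size, then an entire vector is selected."  §'freeze' (L12201): "If an
aggregate value or vector is frozen, the operand is frozen element-wise."  §'Well-Defined Values' (L4608): "An aggregate value or vector is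
well defined if its elements are well defined."  Alive2, Figure 4 (value-aggregate): "v,v′ ∈ Aggregate, |v| = |v′|, ∀i. v[i] ⊒ v′[i] ⟹ v ⊒ v′"
and §5.1 "aggregate values are compared element-wise".

## What is formalised and what is not
A fixed-length vector `<n x ty>` is a function `Fin n → β` from lane indices to lane values (`Vec n β`); the lane value type `β` is
whichever scalar domain the companion files use — `IVal w` (poison-or-defined, `LeeEtAl2017`) for the instruction liftings, `Val α` (Alive2
value sets, `LopesEtAl2021`) for well-definedness and refinement.  Every vector instruction typed here is the LANE-WISE lifting of the scalar
instruction already typed (`lanewise₁/₂/₃`), exactly as the quoted sentences say; the only non-lane-wise clauses the manual prints for these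
instructions are (i) division: UB of the whole operation as soon as ANY divisor element is zero (`VecUB`), and (ii) `select` with a SCALAR
`i1` condition on vector arguments ("an entire vector is selected", `vselectScalar`) — which is provably the same as lane-wise selection with
that condition in every lane.  Refinement of vector values is element-wise (Alive2 value-aggregate), so ONE non-refining lane refutes the
refinement of the vector (`not_vecRefines_of_lane`) — the sentence the CertifiedToolchain class-L lane legs rely on.  Scalable vectors,
`shufflevector`/`insertelement`/`extractelement`, floating-point vectors, vectors of pointers and the memory layout paragraphs of §'Vector
Type' are NOT typed.  Nothing here is a claim about what LLVM's optimiser does.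
-/

namespace Literature.Computability.LLVMLangRef18

namespace VectorOperations

open Literature.Computability.LeeEtAl2017
open Literature.Computability.LopesEtAl2021

variable {n w : ℕ} {α β γ δ ε : Type}

/-! ## Vectors and lane-wise lifting -/

/-- A fixed-length vector value `<n x ty>`: one lane value per element index ("a vector of elements … a size (number of elements), an
underlying primitive data type"). [cite: LLVMLangRef18, §'Vector Type' L3950–3956] -/
abbrev Vec (n : ℕ) (β : Type) : Type := Fin n → β

/-- Lane-wise lifting of a unary scalar operation ("the operand is frozen element-wise"; "the operation occurs for each element").
[cite: LLVMLangRef18, §'freeze' L12201; §'llvm.fshl.*' L16303–16304] -/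
def lanewise₁ (op : β → γ) (a : Vec n β) : Vec n γ := fun i => op (a i)

/-- Lane-wise lifting of a binary scalar operation ("each vector element of ``op1`` is shifted by the corresponding shift amount in
``op2``"; "compared element by element"). [cite: LLVMLangRef18, §'shl' L9856–9857; §'icmp' L11922–11924] -/
def lanewise₂ (op : β → γ → δ) (a : Vec n β) (b : Vec n γ) : Vec n δ := fun i => op (a i) (b i)

/-- Lane-wise lifting of a ternary scalar operation ("For vector types, the operation occurs for each element of the vector"; "the
selection is done element by element"). [cite: LLVMLangRef18, §'llvm.fshl.*' L16303–16304; §'select' L12152–12153] -/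
def lanewise₃ (op : β → γ → δ → ε) (a : Vec n β) (b : Vec n γ) (c : Vec n δ) : Vec n ε := fun i => op (a i) (b i) (c i)

/-- Lane `i` of a lane-wise unary operation. [cite: LLVMLangRef18, §'freeze' L12201] -/
@[simp] theorem lanewise₁_apply (op : β → γ) (a : Vec n β) (i : Fin n) : lanewise₁ op a i = op (a i) := rfl

/-- Lane `i` of a lane-wise binary operation depends on lane `i` of the operands only. [cite: LLVMLangRef18, §'shl' L9856–9857] -/
@[simp] theorem lanewise₂_apply (op : β → γ → δ) (a : Vec n β) (b : Vec n γ) (i : Fin n) : lanewise₂ op a b i = op (a i) (b i) := rfl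

/-- Lane `i` of a lane-wise ternary operation. [cite: LLVMLangRef18, §'llvm.fshl.*' L16303–16304] -/
@[simp] theorem lanewise₃_apply (op : β → γ → δ → ε) (a : Vec n β) (b : Vec n γ) (c : Vec n δ) (i : Fin n) :
    lanewise₃ op a b c i = op (a i) (b i) (c i) := rfl

/-! ## The integer binary operators on vectors (§'add' … §'xor': "integer or vector of integer values. Both arguments must have identical types") -/

/-- `add [nuw] [nsw]` on `<n x iw>`. [cite: LLVMLangRef18, §'add' L9254–9256 and L9261–9273] -/
def vadd (nuw nsw : Bool) : Vec n (IVal w) → Vec n (IVal w) → Vec n (IVal w) := lanewise₂ (add nuw nsw)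
/-- `sub [nuw] [nsw]` on `<n x iw>`. [cite: LLVMLangRef18, §'sub' L9349–9351 and L9356–9368] -/
def vsub (nuw nsw : Bool) : Vec n (IVal w) → Vec n (IVal w) → Vec n (IVal w) := lanewise₂ (sub nuw nsw)
/-- `mul [nuw] [nsw]` on `<n x iw>`. [cite: LLVMLangRef18, §'mul' L9443–9445 and L9450–9466] -/
def vmul (nuw nsw : Bool) : Vec n (IVal w) → Vec n (IVal w) → Vec n (IVal w) := lanewise₂ (mul nuw nsw)
/-- `and` on `<n x iw>`. [cite: LLVMLangRef18, §'and' L10000–10002 and L10007–10019] -/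
def vand : Vec n (IVal w) → Vec n (IVal w) → Vec n (IVal w) := lanewise₂ LLVMLangRef18.and
/-- `or [disjoint]` on `<n x iw>`: "For vectors, only the element containing the bit is poison." [cite: LLVMLangRef18, §'or' L10052–10054 and L10073–10077] -/
def vor (disjoint : Bool) : Vec n (IVal w) → Vec n (IVal w) → Vec n (IVal w) := lanewise₂ (LLVMLangRef18.or disjoint)
/-- `xor` on `<n x iw>`. [cite: LLVMLangRef18, §'xor' L10110–10112 and L10117–10129] -/
def vxor : Vec n (IVal w) → Vec n (IVal w) → Vec n (IVal w) := lanewise₂ LLVMLangRef18.xor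

/-- **`or disjoint` on vectors: "only the element containing the bit is poison"** — lane `i` is poison exactly when lane `i`'s (defined)
operands have a one in the same bit position; the other lanes are whatever their own operands give. [cite: LLVMLangRef18, §'or' L10075–10077] -/
theorem vor_disjoint_lane (a b : Vec n (IVal w)) (i : Fin n) (x y : BitVec w) (ha : a i = some x) (hb : b i = some y) :
    vor true a b i = (if CommonOne x y then IVal.poison else some (x ||| y)) := by
  simp [vor, LLVMLangRef18.or, ha, hb, orV]

/-- … in particular a lane whose operands share a one bit is poison while a lane whose operands are disjoint is the defined or.
[cite: LLVMLangRef18, §'or' L10075–10077] -/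
theorem vor_disjoint_lane_poison_iff (a b : Vec n (IVal w)) (i : Fin n) (x y : BitVec w) (ha : a i = some x) (hb : b i = some y) :
    vor true a b i = IVal.poison ↔ CommonOne x y := by
  rw [vor_disjoint_lane a b i x y ha hb]
  by_cases h : CommonOne x y <;> simp [h]

/-! ## Shifts and funnel shifts on vectors -/

/-- `shl [nuw] [nsw]` on `<n x iw>`: "each vector element of ``op1`` is shifted by the corresponding shift amount in ``op2``".
[cite: LLVMLangRef18, §'shl' L9852–9857] -/
def vshl (nuw nsw : Bool) : Vec n (IVal w) → Vec n (IVal w) → Vec n (IVal w) := lanewise₂ (shl nuw nsw)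
/-- `lshr [exact]` on `<n x iw>`, same sentence. [cite: LLVMLangRef18, §'lshr' L9905–9910] -/
def vlshr (exact : Bool) : Vec n (IVal w) → Vec n (IVal w) → Vec n (IVal w) := lanewise₂ (lshr exact)
/-- `ashr [exact]` on `<n x iw>`, same sentence. [cite: LLVMLangRef18, §'ashr' L9957–9962] -/
def vashr (exact : Bool) : Vec n (IVal w) → Vec n (IVal w) → Vec n (IVal w) := lanewise₂ (ashr exact)
/-- `llvm.fshl` on `<n x iw>`: "For vector types, the operation occurs for each element of the vector." [cite: LLVMLangRef18, §'llvm.fshl.*' L16296–16305] -/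
def vfshl : Vec n (IVal w) → Vec n (IVal w) → Vec n (IVal w) → Vec n (IVal w) := lanewise₃ fshl
/-- `llvm.fshr` on `<n x iw>`, same sentence. [cite: LLVMLangRef18, §'llvm.fshr.*' L16346–16353] -/
def vfshr : Vec n (IVal w) → Vec n (IVal w) → Vec n (IVal w) → Vec n (IVal w) := lanewise₃ fshr

/-- A lane with an over-wide shift amount is poison whatever the other lanes do (`lshr`; "If ``op2`` is … equal to or larger than the number
of bits in ``op1``, this instruction returns a poison value. If the arguments are vectors, each vector element …"). [cite: LLVMLangRef18, §'lshr' L9907–9910] -/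
theorem vlshr_lane_poison_of_ge (exact : Bool) (a s : Vec n (IVal w)) (i : Fin n) (x c : BitVec w) (ha : a i = some x) (hs : s i = some c)
    (hc : w ≤ c.toNat) : vlshr exact a s i = IVal.poison := by
  simp [vlshr, lshr, ha, hs, lshrV, hc]

/-! ## Division and remainder on vectors: UB is ANY-element -/

/-- A vector result one of whose lanes is immediate UB: the operation "has undefined behavior". [cite: LLVMLangRef18, §'udiv' L9549–9550] -/
def VecUB (r : Vec n (OrUB w)) : Prop := ∃ i, r i = OrUB.ub

/-- `udiv [exact]` on `<n x iw>` (lane-wise scalar results, UB read by `VecUB`). [cite: LLVMLangRef18, §'udiv' L9537–9539 and L9544–9555] -/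
def vudiv (exact : Bool) : Vec n (IVal w) → Vec n (IVal w) → Vec n (OrUB w) := lanewise₂ (udiv exact)
/-- `sdiv [exact]` on `<n x iw>`. [cite: LLVMLangRef18, §'sdiv' L9585–9587 and L9592–9604] -/
def vsdiv (exact : Bool) : Vec n (IVal w) → Vec n (IVal w) → Vec n (OrUB w) := lanewise₂ (sdiv exact)
/-- `urem` on `<n x iw>`. [cite: LLVMLangRef18, §'urem' L9675–9677 and L9682–9691] -/
def vurem : Vec n (IVal w) → Vec n (IVal w) → Vec n (OrUB w) := lanewise₂ urem
/-- `srem` on `<n x iw>`. [cite: LLVMLangRef18, §'srem' L9723–9725 and L9730–9750] -/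
def vsrem : Vec n (IVal w) → Vec n (IVal w) → Vec n (OrUB w) := lanewise₂ srem

/-- **"For vectors, if any element of the divisor is zero, the operation has undefined behavior."** [cite: LLVMLangRef18, §'udiv' L9549–9550] -/
theorem vudiv_ub_of_lane_zero (exact : Bool) (a b : Vec n (IVal w)) (i : Fin n) (hb : b i = some (0#w)) : VecUB (vudiv exact a b) :=
  ⟨i, by simp [vudiv, udiv, hb]⟩

/-- Same sentence for `sdiv`. [cite: LLVMLangRef18, §'sdiv' L9598–9599] -/
theorem vsdiv_ub_of_lane_zero (exact : Bool) (a b : Vec n (IVal w)) (i : Fin n) (hb : b i = some (0#w)) : VecUB (vsdiv exact a b) :=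
  ⟨i, by simp [vsdiv, sdiv, hb]⟩

/-- Same sentence for `urem`. [cite: LLVMLangRef18, §'urem' L9690–9691] -/
theorem vurem_ub_of_lane_zero (a b : Vec n (IVal w)) (i : Fin n) (hb : b i = some (0#w)) : VecUB (vurem a b) :=
  ⟨i, by simp [vurem, urem, hb]⟩

/-- Same sentence for `srem`. [cite: LLVMLangRef18, §'srem' L9744–9745] -/
theorem vsrem_ub_of_lane_zero (a b : Vec n (IVal w)) (i : Fin n) (hb : b i = some (0#w)) : VecUB (vsrem a b) :=
  ⟨i, by simp [vsrem, srem, hb]⟩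

/-- Conversely a vector division is UB only through some lane's scalar UB (zero or poison divisor, or the `sdiv` overflow case): the vector
form adds no UB of its own. [cite: LLVMLangRef18, §'udiv' L9549–9550] -/
theorem vecUB_vudiv_iff (exact : Bool) (a b : Vec n (IVal w)) : VecUB (vudiv exact a b) ↔ ∃ i, udiv exact (a i) (b i) = OrUB.ub := Iff.rfl

/-! ## `icmp` and `select` on vectors -/

/-- `icmp` on `<n x iw>`: "compared element by element. The result is an ``i1`` vector with the same number of elements".
[cite: LLVMLangRef18, §'icmp' L11922–11924] -/
def vicmp (c : Cond) : Vec n (IVal w) → Vec n (IVal w) → Vec n (IVal 1) := lanewise₂ (icmp c)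

/-- Lane `i` of a vector `icmp` is the scalar `icmp` of lane `i`. [cite: LLVMLangRef18, §'icmp' L11922–11924] -/
theorem vicmp_apply (c : Cond) (a b : Vec n (IVal w)) (i : Fin n) : vicmp c a b i = icmp c (a i) (b i) := rfl

/-- `select` with a VECTOR condition `<n x i1>`: "the selection is done element by element" (per lane, the scalar `select` of
`LeeEtAl2017.IVal.select`, with which the manual's defined-condition sentence agrees, `select_defined_eq`). [cite: LLVMLangRef18, §'select' L12152–12153] -/
def vselect (c : Vec n (IVal 1)) (a b : Vec n (IVal w)) : Vec n (IVal w) := lanewise₃ IVal.select c a b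

/-- `select` with a SCALAR `i1` condition on vector arguments: "an entire vector is selected" (a poison condition gives the all-poison
vector, PLDI'17 Fig. 5). [cite: LLVMLangRef18, §'select' L12154–12155] -/
def vselectScalar (c : IVal 1) (a b : Vec n (IVal w)) : Vec n (IVal w) :=
  match c with
  | none => fun _ => IVal.poison
  | some t => if t = 1#1 then a else b

/-- "an entire vector is selected": on a defined condition the result IS one of the two argument vectors. [cite: LLVMLangRef18, §'select' L12154–12155] -/
theorem vselectScalar_defined (t : BitVec 1) (a b : Vec n (IVal w)) : vselectScalar (some t) a b = if t = 1#1 then a else b := rfl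

/-- The scalar-condition form is the element-by-element form with the condition repeated in every lane (so one lane semantics covers both
printed cases). [cite: LLVMLangRef18, §'select' L12152–12155] -/
theorem vselectScalar_eq_vselect (c : IVal 1) (a b : Vec n (IVal w)) : vselectScalar c a b = vselect (fun _ => c) a b := by
  funext i
  rcases c with _ | t
  · rfl
  · simp only [vselectScalar, vselect, lanewise₃, IVal.select, Option.bind_some]
    split <;> rfl

/-- Lane `i` of a vector `select`. [cite: LLVMLangRef18, §'select' L12152–12153] -/
theorem vselect_apply (c : Vec n (IVal 1)) (a b : Vec n (IVal w)) (i : Fin n) : vselect c a b i = IVal.select (c i) (a i) (b i) := rfl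

/-! ## `freeze` and well-definedness on vectors -/

/-- `freeze` on `<n x iw>`: "the operand is frozen element-wise" — lane by lane the scalar freeze relation `IsFreezeOf`.
[cite: LLVMLangRef18, §'freeze' L12201] -/
def VIsFreezeOf (a : Vec n (IVal w)) (r : Vec n (BitVec w)) : Prop := ∀ i, IsFreezeOf (a i) (r i)

/-- Element-wise freeze keeps every defined lane and may pick anything in a poison lane (the printed `<2 x i32>` example, L12225–12226:
"element-wise freeze"). [cite: LLVMLangRef18, §'freeze' L12201 and L12225–12226] -/
theorem vIsFreezeOf_iff (a : Vec n (IVal w)) (r : Vec n (BitVec w)) : VIsFreezeOf a r ↔ ∀ i v, a i = some v → r i = v := Iff.rfl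

/-- "An aggregate value or vector is well defined if its elements are well defined" (value-set model of `UndefinedValues`).
[cite: LLVMLangRef18, §'Well-Defined Values' L4608] -/
def VecWellDefined (v : Vec n (Val α)) : Prop := ∀ i, UndefinedValues.WellDefined (v i)

/-- A vector with an `undef` (or `poison`) lane is not well defined (width ≥ 1). [cite: LLVMLangRef18, §'Well-Defined Values' L4607–4608] -/
theorem not_vecWellDefined_of_undef_lane {sz : ℕ} (hsz : 0 < sz) (v : Vec n (Val (BitVec sz))) (i : Fin n) (hi : v i = Val.undef) :
    ¬ VecWellDefined v := by
  intro h
  obtain ⟨a, ha⟩ := h i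
  rw [hi] at ha
  have h2 := congrArg (fun u : Val (BitVec sz) => match u with | Val.vals s => s | Val.poison => ∅) ha
  simp only [Val.undef, Val.defined] at h2
  have hmem : (a + 1 : BitVec sz) ∈ (Set.univ : Set (BitVec sz)) := Set.mem_univ _
  rw [h2, Set.mem_singleton_iff] at hmem
  have h1 : (1 : BitVec sz) = 0 := by
    have := congrArg (· - a) hmem
    simpa using this
  have h3 := congrArg (fun u : BitVec sz => u.getLsbD 0) h1
  simp [hsz] at h3

/-! ## Refinement of vector values is element-wise (Alive2, Figure 4 value-aggregate) -/

/-- **value-aggregate:** "v,v′ ∈ Aggregate, |v| = |v′|, ∀i. v[i] ⊒ v′[i] ⟹ v ⊒ v′" — a vector source value is refined by a vector target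
value iff every lane is ("aggregate values are compared element-wise", §5.1). [cite: LopesEtAl2021, Figure 4 (value-aggregate) and §5.1] -/
def VecRefines (v v' : Vec n (Val α)) : Prop := ∀ i, Val.Refines (v i) (v' i)

/-- Element-wise refinement is reflexive. [cite: LopesEtAl2021, Figure 4 (value-aggregate)] -/
theorem vecRefines_refl (v : Vec n (Val α)) : VecRefines v v := fun i => Val.refines_refl (v i)

/-- Element-wise refinement is transitive. [cite: LopesEtAl2021, Figure 4 (value-aggregate) and §5] -/
theorem vecRefines_trans {u v t : Vec n (Val α)} (h₁ : VecRefines u v) (h₂ : VecRefines v t) : VecRefines u t :=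
  fun i => Val.refines_trans (h₁ i) (h₂ i)

/-- **ONE non-refining lane refutes the refinement of the vector.** [cite: LopesEtAl2021, Figure 4 (value-aggregate)] -/
theorem not_vecRefines_of_lane {v v' : Vec n (Val α)} (i : Fin n) (h : ¬ Val.Refines (v i) (v' i)) : ¬ VecRefines v v' :=
  fun hv => h (hv i)

/-- The same rule read on poison-or-defined lanes through `Val.ofOption` (`none ↦ poison`, `some a ↦ defined a`): every lane is poison in
the source or equal. [cite: LopesEtAl2021, Figure 4 (value-aggregate, value-poison)] -/
theorem vecRefines_ofOption_iff (v v' : Vec n (Option α)) :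
    VecRefines (lanewise₁ Val.ofOption v) (lanewise₁ Val.ofOption v') ↔ ∀ i, v i = none ∨ v i = v' i := by
  simp only [VecRefines, lanewise₁_apply, Val.ofOption_refines_ofOption_iff]

end VectorOperations

end Literature.Computability.LLVMLangRef18
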